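import Literature.Analysis.FluidPDE.KNSSTypeIIHolds
import Literature.Analysis.FluidPDE.TaoLocalisationHolds
import Literature.Analysis.FluidPDE.NSVorticityBKMContinuation
import HarnessLib

/-!
# Route `TautLoopKelvin`, crux `TautCompressionIntegrable` (stmt-NavierStokesRegularity-15248),
  line `birth` — stub `stub_fderiv_bound_of_velocity_bound` (the bounded regime)

**Statement.** Let `ν > 0`, `T > 0`, and let `(u, p)` be a classical solution of the unforced
Navier–Stokes system on `ℝ³ × [0, T)` which is Leray–Hopf on `[0, T]` from its rapidly decaying
datum `u 0`. If the velocity is bounded on `[0, T) × ℝ³`, then the velocity gradient is bounded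
on `[0, T) × ℝ³`: `∃ L ≥ 0, ∀ s ∈ [0, T), ∀ x, ‖D(u s)(x)‖ ≤ L`.

**Proof** (composition of proved tree theorems).
1. A bounded classical Leray–Hopf solution continues past `T`
   (`hasSmoothExtensionPast_of_bounded_holds`, Robinson–Rodrigo–Sadowski 2016, Thm. 8.17): there
   are `T₂ > T` and a classical `(u', p')` on `[0, T₂)` with `u' = u` on `[0, T)`.
2. `(u', p')` is classical on the closed slab `[0, T]` (`IsClassicalNSSolutionOn.mono`).
3. Its energy is bounded on `[0, T]` by `2 E(u 0)`: for `t < T` this is the Leray–Hopf energy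
   inequality (`IsLerayHopfOn.lintegral_enorm_sq_le`); at `t = T` it follows by Fatou
   (`MeasureTheory.lintegral_liminf_le`) along `tₙ = T − T/(n+1) ↑ T`, using the continuity in
   time of the classical `u'`.
4. Tao 2013, Cor. 11.1 (`tao2011_hasBoundedSobolevNormsOn_holds`) bounds all `L²` Sobolev norms
   of `u'` on `[0, T]` (the datum `u' 0 = u 0` is rapidly decaying).
5. The Sobolev imbedding on the gradient
   (`exists_forall_norm_fderiv_le_of_hasBoundedSobolevNormsOn`) bounds `‖D(u' t)(x)‖` on
   `[0, T] × ℝ³`; transfer to `u` on `[0, T)` by `u' = u` there.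

Sources: J. C. Robinson, J. L. Rodrigo, W. Sadowski, *The Three-Dimensional Navier–Stokes
Equations*, CUP 2016, Thm. 8.17; T. Tao, *Localisation and compactness properties of the
Navier–Stokes global regularity problem*, Anal. PDE 6 (2013), Cor. 11.1; R. A. Adams,
*Sobolev Spaces* (1975), Thm. 5.4; J. Leray, Acta Math. 63 (1934) (energy inequality).
-/

noncomputable section

open Set MeasureTheory Filter Topology Function
open scoped ENNReal NNReal
open Literature.Analysis.FluidPDE

namespace Summit.NavierStokesRegularity.NavierStokesRegularity.Theorems.TautCompressionIntegrable.Birth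

-- the problem-side namespace `Summit.NavierStokesRegularity.NavierStokesRegularity.…` (summit =
-- problem for this single-problem summit) duplicates `NavierStokesRegularity` by design
set_option linter.dupNamespace false

/-- **Energy bound at the closed endpoint by Fatou.** If `u'` is a classical solution on
`[0, T₂)`, `0 < T < T₂`, and `∫ ‖u' t‖² ≤ C` for all `t ∈ [0, T)`, then also `∫ ‖u' T‖² ≤ C`
(Fatou along `tₙ = T − T/(n+1) → T`, with pointwise convergence `u' tₙ x → u' T x` from the joint
smoothness of `u'`). -/
private theorem tautGrad_lintegral_endpoint_le {ν T T₂ : ℝ} (hT : 0 < T) (hTT₂ : T < T₂)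
    {u' : ℝ → EuclideanSpace ℝ (Fin 3) → EuclideanSpace ℝ (Fin 3)}
    {p' : ℝ → EuclideanSpace ℝ (Fin 3) → ℝ}
    (h' : IsClassicalNSSolutionOn (Ico 0 T₂) ν 0 u' p') {C : ℝ≥0∞}
    (hC : ∀ t ∈ Ico 0 T, ∫⁻ x, ‖u' t x‖ₑ ^ 2 ≤ C) :
    ∫⁻ x, ‖u' T x‖ₑ ^ 2 ≤ C := by
  -- the approximating times
  set tseq : ℕ → ℝ := fun n => T - T / ((n : ℝ) + 1) with htseq
  have hmem : ∀ n, tseq n ∈ Ico 0 T := by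
    intro n
    have hn : (0 : ℝ) < (n : ℝ) + 1 := by positivity
    have h1 : 0 < T / ((n : ℝ) + 1) := div_pos hT hn
    have h2 : T / ((n : ℝ) + 1) ≤ T := div_le_self hT.le (by linarith)
    refine ⟨?_, ?_⟩
    · simp only [htseq]; linarith
    · simp only [htseq]; linarith
  have htend : Tendsto tseq atTop (𝓝 T) := by
    have h1 : Tendsto (fun n : ℕ => T * (1 / ((n : ℝ) + 1))) atTop (𝓝 (T * 0)) :=
      (tendsto_one_div_add_atTop_nhds_zero_nat (𝕜 := ℝ)).const_mul T
    have h2 : Tendsto (fun n : ℕ => T - T * (1 / ((n : ℝ) + 1))) atTop (𝓝 (T - T * 0)) :=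
      tendsto_const_nhds.sub h1
    simp only [mul_zero, sub_zero] at h2
    refine h2.congr fun n => ?_
    simp only [htseq, mul_one_div]
  have hTmem : T ∈ Ico 0 T₂ := ⟨hT.le, hTT₂⟩
  have htendW : Tendsto tseq atTop (𝓝[Ico 0 T₂] T) :=
    tendsto_nhdsWithin_iff.2 ⟨htend, Eventually.of_forall fun n =>
      ⟨(hmem n).1, (hmem n).2.trans hTT₂⟩⟩
  -- pointwise convergence of the integrands
  have hptw : ∀ x, liminf (fun n => ‖u' (tseq n) x‖ₑ ^ 2) atTop = ‖u' T x‖ₑ ^ 2 := by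
    intro x
    have hcont : ContinuousWithinAt (fun s => u' s x) (Ico 0 T₂) T :=
      (h'.smooth_velocity.differentiableWithinAt_time hTmem x).continuousWithinAt
    have hx : Tendsto (fun n => u' (tseq n) x) atTop (𝓝 (u' T x)) := hcont.tendsto.comp htendW
    exact (ENNReal.Tendsto.pow (n := 2) hx.enorm).liminf_eq
  have hmeas : ∀ n, Measurable fun x => ‖u' (tseq n) x‖ₑ ^ 2 := fun n =>
    (h'.contDiff_velocity ⟨(hmem n).1, (hmem n).2.trans hTT₂⟩).continuous.measurable.enorm.pow_const
      2
  calc ∫⁻ x, ‖u' T x‖ₑ ^ 2 = ∫⁻ x, liminf (fun n => ‖u' (tseq n) x‖ₑ ^ 2) atTop :=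
        lintegral_congr fun x => (hptw x).symm
    _ ≤ liminf (fun n => ∫⁻ x, ‖u' (tseq n) x‖ₑ ^ 2) atTop := lintegral_liminf_le hmeas
    _ ≤ C := liminf_le_of_frequently_le' (Frequently.of_forall fun n => hC (tseq n) (hmem n))

/-- **stub 2 — `stub_fderiv_bound_of_velocity_bound` (the bounded regime).** A classical
solution of unforced NS on `ℝ³ × [0,T)`, Leray–Hopf on `[0,T]` from a rapidly decaying datum, whose
velocity is bounded on `[0,T) × ℝ³`, has bounded velocity gradient on `[0,T) × ℝ³`: continuation
past `T` of bounded Leray–Hopf solutions (`hasSmoothExtensionPast_of_bounded_holds`, RRS 2016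
Thm. 8.17), energy bound on the closed slab (Leray–Hopf energy inequality and Fatou at `t = T`),
`H^k` bounds on the closed slab (`tao2011_hasBoundedSobolevNormsOn_holds`, Tao 2013 Cor. 11.1),
Sobolev imbedding on the gradient (`exists_forall_norm_fderiv_le_of_hasBoundedSobolevNormsOn`). -/
theorem stub_fderiv_bound_of_velocity_bound :
    ∀ (ν T : ℝ), 0 < ν → 0 < T →
      ∀ (u : ℝ → EuclideanSpace ℝ (Fin 3) → EuclideanSpace ℝ (Fin 3)) (p : ℝ → EuclideanSpace ℝ (Fin 3) → ℝ),
      Literature.Analysis.FluidPDE.IsClassicalNSSolutionOn (Set.Ico 0 T) ν 0 u p →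
      Literature.Analysis.FluidPDE.IsLerayHopfOn T ν 0 (u 0) u →
      Literature.Analysis.FluidPDE.HasRapidSpatialDecay (u 0) →
      (∃ B : ℝ, ∀ s ∈ Set.Ico 0 T, ∀ x, ‖u s x‖ ≤ B) →
      ∃ L : ℝ, 0 ≤ L ∧ ∀ s ∈ Set.Ico 0 T, ∀ x, ‖fderiv ℝ (u s) x‖ ≤ L := by
  intro ν T hν hT u p hsol hLH hdec hbdd
  -- (1) continuation past `T`
  obtain ⟨T₂, hTT₂, u', p', h', hagree⟩ := hasSmoothExtensionPast_of_bounded_holds hν hT hsol hLH hbdd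
  -- (2) classical on the closed slab `[0, T]`
  have hsolc : IsClassicalNSSolutionOn (Icc 0 T) ν 0 u' p' :=
    h'.mono (Icc_subset_Ico_right hTT₂) (uniqueDiffOn_Icc hT)
  -- (3) energy bound on `[0, T]`
  have hEo : ∀ t ∈ Ico 0 T,
      ∫⁻ x, ‖u' t x‖ₑ ^ 2 ≤ ((2 * VectorCalculus.kineticEnergy (u 0)).toNNReal : ℝ≥0∞) := by
    intro t ht
    rw [hagree t ht]
    exact hLH.lintegral_enorm_sq_le hν.le ⟨ht.1, ht.2.le⟩
  have hE : ∃ C : ℝ≥0, ∀ t ∈ Icc 0 T, ∫⁻ x, ‖u' t x‖ₑ ^ 2 ≤ C := by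
    refine ⟨(2 * VectorCalculus.kineticEnergy (u 0)).toNNReal, fun t ht => ?_⟩
    rcases ht.2.lt_or_eq with htT | htT
    · exact hEo t ⟨ht.1, htT⟩
    · rw [htT]
      exact tautGrad_lintegral_endpoint_le hT hTT₂ h' hEo
  -- (4) bounded Sobolev norms on `[0, T]`
  have hdec' : HasRapidSpatialDecay (u' 0) := by
    rw [hagree 0 ⟨le_rfl, hT⟩]
    exact hdec
  have hB : HasBoundedSobolevNormsOn (Icc 0 T) u' :=
    tao2011_hasBoundedSobolevNormsOn_holds hν hT hsolc hE hdec'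
  -- (5) Sobolev imbedding on the gradient, (6) transfer to `u`
  obtain ⟨L, hL0, hL⟩ := exists_forall_norm_fderiv_le_of_hasBoundedSobolevNormsOn
    (fun t ht => (hsolc.contDiff_velocity ht).of_le (by norm_cast)) hB
  refine ⟨L, hL0, fun s hs x => ?_⟩
  rw [← hagree s hs]
  exact hL s (Ico_subset_Icc_self hs) x

end Summit.NavierStokesRegularity.NavierStokesRegularity.Theorems.TautCompressionIntegrable.Birth

end
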